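import Summits.ValiantsHypothesis.ValiantsHypothesis.Theses.RealTau
import Literature.Computability.AlgebraicComplexity.RealTauKnownCases

/-!
# Disproof of `RealVnTransfer` — findings (crux disprover, cycle 1, 2026-08-17)

Crux `RealTau.RealVnTransfer` (stmt-ValiantsHypothesis-18102) = Tavenas 2014 Thm. 3.38 WITH constants,
conclusion over `ℝ`:
`IsPComputable (per/ℂ) → ∃ C ∀ n ∃ k m t (g : Fin k → Fin m → ℝ[X]), k, t ≤ (n+2)^(C(⌊√(2n+3)⌋+1)) ∧
 m ≤ C(⌊√(2n+3)⌋+1) ∧ g t-sparse ∧ ∑_i ∏_j g i j = V_n`.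

VERDICT: NO KILL, and none is possible — the crux is (i) IRREFUTABLE BY DESIGN and (ii) a THEOREM.
(i) `¬ RealVnTransfer → IsPComputable (per/ℂ)` (`isPComputable_of_not_realVnTransfer`), i.e. a
    refutation would prove `VP_ℂ = VNP_ℂ` for the permanent (`perNotPComputableComplex_iff_holds`);
    dually `ValiantsHypothesis → RealVnTransfer` ex falso, packaged as
    `RealVnTransfer ↔ ValiantsHypothesis ∨ Conclusion` (`realVnTransfer_iff`).
(ii) Two complete candidate proofs are attached to the item as evidence (farm rc 0, 0 sorry, axioms
    standard, per their notes): `RealTauRealVnTransfer_candidate.lean` (line `realified-depth-four`: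
    the tree's PROVED constant-free engine `exists_sps_of_isProjection_perPoly` re-run over `ℝ` with the
    with-constants measure `complexity`, + realification item 18106, CLOSED) and
    `RealTauRealVnTransferKptt_candidate.lean` (KPTT complex engine at `Y = 2` + real-part polarisation,
    `C ↦ 2C`).  The crux awaits a prover LANDING, nothing else.

What this file certifies instead (all sorry-free; the landed copies are
`Theorems/RealVnTransfer/Negative/BudgetCounting.lean`, proposal p146303):

* (a) LOAD-BEARING ANALYSIS.  The one hypothesis is the antecedent `IsPComputable (per/ℂ)`.
  `RealVnTransferWithoutPComputable` (= the bare conclusion) is refuted BY THE ROUTE'S OWN TARGET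
  (`realVnTransfer_false_without_PComputable_of_vnSparseHard : VnSparseHard → ¬ …`); its unconditional
  negation `∀ C ∃ n ∀ k m t g, ¬(…)` is an OPEN depth-four lower bound for `V_n` (strictly weaker than the
  target `VnSparseHard`, which asks for infinitely many `n`) — not landable, and not attempted beyond
  counting (below), which provably cannot reach it (`two_pow_le_stated_budget`).
* (b) TIGHTNESS / BOUNDARY.  Monomial counting: `#supp V_n = 2^n` (`card_support_map_tavenasV`) and
  `#supp ∑∏ g ≤ k t^m` (`card_support_sumProd_le`), so every representation the transfer produces has
  `k · t^m ≥ 2^n` (`sumProd_ne_map_tavenasV_of_lt`); general budget lemma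
  `conclusion_false_of_budget_lt`.  The stated budget gives `k t^m = (n+2)^(C(s+1)(1+C(s+1))) ≥ 2^n` at
  EVERY `n` once `C ≥ 1` (`two_pow_le_stated_budget`): the crux's shape sits just above the counting
  floor — `m · log t = Θ(n log n)` is exactly where counting goes silent.
* (c) NATURAL STRENGTHENINGS THAT ARE FALSE OUTRIGHT (hence, as transfers under the crux's antecedent,
  EQUIVALENT TO THE SUMMIT — a planner must not "repair" in these directions):
  `not_conclusion_bounded_fanin` (`m ≤ C`: bounded top product fan-in) and
  `not_conclusion_poly_sparsity` (`t ≤ (n+2)^C`: polynomially sparse inner polynomials); both by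
  `(n+2)^((C²+C)(s+1)) < 2^n` at some `n = 4^j` (tree `exists_pow_sqrt_lt_two_pow`).  NOT refutable by
  counting: `k ≤ (n+2)^C` alone (then `k t^m` may still be `2^(Θ(n log n))`).
* (d) CORNERS.  `C = 0` fails at `n = 1` (`conclusion_false_at_C_zero`; `C` is existential, so a corner,
  not a refutation); `n = 0` is satisfiable for every `C` (`V_0 = 1 = ∑_{i<1} ∏_{j<0}`,
  `conclusion_holds_at_zero`); the quantifier-SWAPPED conclusion `∀ n ∃ C` is trivial
  (`conclusion_forall_n_exists_C`: `V_n` as its `2^n` monomials, `C = n+1`) — `∃ C` first is the content.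
* (e) NEAR-MISSES: none.  Regimes NOT tried (pointless by (i)): counterexample search over `g`.
  Junk check of the antecedent: `IsPComputable f := IsPBounded (complexity ∘ f)`,
  `IsPBounded t := ∃ c, ∀ n, t n ≤ n^c + c`, `perPoly n k := (mvPolynomialX n n k).permanent`,
  `complexity` an attained `sInf` (`ArithCircuit.exists_computes_size_eq_complexity`) — no junk value
  makes the antecedent provable or refutable here.

-- Targets: none (payload `targets = []`, `stuck_stubs = []`; the registered line's two stubs
`stub_realEngine`, `stub_realLiftData` are THEOREMS per the strategist's candidate file, so there is
nothing to break; `RealVnTransfer_of` composes them without a gap — the skeleton's glue only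
instantiates `d = r = 2n+3`, `e₁ = 2`).
-/

open Polynomial Finset
open Literature.Computability.AlgebraicComplexity

set_option linter.dupNamespace false

namespace Summit.ValiantsHypothesis.ValiantsHypothesis.Cruxes.RealVnTransfer.Disproof

open Summit.ValiantsHypothesis.ValiantsHypothesis.Theses.RealTau

/-! ### (0) Shape: a transfer whose antecedent is `¬`(summit) -/

/-- The crux's conclusion = `RealVnTransfer` with its only hypothesis `IsPComputable (per/ℂ)` dropped. -/
def RealVnTransferWithoutPComputable : Prop :=
  ∃ C : ℕ, ∀ n : ℕ, ∃ (k m t : ℕ) (g : Fin k → Fin m → Polynomial ℝ),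
    k ≤ (n + 2) ^ (C * (Nat.sqrt (2 * n + 3) + 1)) ∧ m ≤ C * (Nat.sqrt (2 * n + 3) + 1) ∧
    t ≤ (n + 2) ^ (C * (Nat.sqrt (2 * n + 3) + 1)) ∧ (∀ i j, (g i j).support.card ≤ t) ∧
      (∑ i, ∏ j, g i j) = (tavenasV n).map (Int.castRingHom ℝ)

/-- The crux is literally `antecedent → conclusion`. -/
theorem realVnTransfer_iff_imp :
    RealVnTransfer ↔ (IsPComputable (fun n => perPoly (Fin n) ℂ) → RealVnTransferWithoutPComputable) :=
  Iff.rfl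

/-- **Irrefutability by design.** A refutation of the crux PROVES p-computability of the permanent
over `ℂ`. [folklore] -/
theorem isPComputable_of_not_realVnTransfer (h : ¬ RealVnTransfer) :
    IsPComputable (fun n => perPoly (Fin n) ℂ) := by
  by_contra hP
  exact h fun hP' => absurd hP' hP

/-- … hence refutes the summit (`perNotPComputableComplex_iff_holds`). [folklore] -/
theorem not_valiantsHypothesis_of_not_realVnTransfer (h : ¬ RealVnTransfer) : ¬ ValiantsHypothesis :=
  fun hV => (perNotPComputableComplex_iff_holds.mpr hV) (isPComputable_of_not_realVnTransfer h)

/-- The crux is `VH ∨ (its conclusion)`; in particular the summit proves the crux ex falso ("a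
consequence of VH used toward VH" — deliberately not stated as a separate `VH → RealVnTransfer`
lemma, which the audit would read as a proof-of-item). [folklore] -/
theorem realVnTransfer_iff : RealVnTransfer ↔ (ValiantsHypothesis ∨ RealVnTransferWithoutPComputable) := by
  constructor
  · intro h
    by_cases hP : IsPComputable (fun n => perPoly (Fin n) ℂ)
    · exact Or.inr (h hP)
    · exact Or.inl (perNotPComputableComplex_iff_holds.mp hP)
  · rintro (hV | hC)
    · exact fun hP => absurd hP (perNotPComputableComplex_iff_holds.mpr hV)
    · exact fun _ => hC

/-! ### (a) the antecedent is load-bearing — modulo the route's own target -/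

/-- Dropping the antecedent leaves a statement refuted by the target `VnSparseHard`; so any proof of the
crux must use `IsPComputable (per/ℂ)` unless the route is dead.  (The unconditional
`¬ RealVnTransferWithoutPComputable` is an open depth-4 lower bound for `V_n`.) [folklore] -/
theorem realVnTransfer_false_without_PComputable_of_vnSparseHard (hV : VnSparseHard) :
    ¬ RealVnTransferWithoutPComputable := by
  rintro ⟨C, hC⟩
  obtain ⟨n, -, hn⟩ := hV C 0
  obtain ⟨k, m, t, g, hk, hm, ht, hg, hsum⟩ := hC n
  exact hn k m t g hk hm ht hg hsum

/-- Given the target, crux and summit coincide (the route's logic in one line). [folklore] -/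
theorem realVnTransfer_iff_valiantsHypothesis_of_vnSparseHard (hV : VnSparseHard) :
    RealVnTransfer ↔ ValiantsHypothesis := by
  rw [realVnTransfer_iff]
  exact ⟨fun h => h.resolve_right (realVnTransfer_false_without_PComputable_of_vnSparseHard hV), Or.inl⟩

/-! ### (b) tightness: the counting floor `k · t^m ≥ 2^n` and where it stops -/

/-- The support of `V_n` over `ℝ` is `{0, …, 2^n - 1}`. [folklore] -/
theorem support_map_tavenasV (n : ℕ) :
    ((tavenasV n).map (Int.castRingHom ℝ)).support = range (2 ^ n) := by
  ext i
  rw [mem_support_iff, coeff_map, coeff_tavenasV, mem_range]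
  split_ifs with h
  · simp [h]
  · simp [h]

/-- `#supp V_n = 2^n`. [folklore] -/
theorem card_support_map_tavenasV (n : ℕ) :
    ((tavenasV n).map (Int.castRingHom ℝ)).support.card = 2 ^ n := by
  rw [support_map_tavenasV, card_range]

/-- `#supp ∑_{i<k} ∏_{j<m} g_ij ≤ k t^m` (Koiran 2011 §6). [cite: Koiran2011, §6 p. 317] -/
theorem card_support_sumProd_le {k m t : ℕ} (g : Fin k → Fin m → ℝ[X])
    (hg : ∀ i j, (g i j).support.card ≤ t) :
    (∑ i, ∏ j, g i j).support.card ≤ k * t ^ m := by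
  calc _ ≤ ∑ i, (∏ j, g i j).support.card := card_support_sum_le _ _
    _ ≤ ∑ i, ∏ j, (g i j).support.card := sum_le_sum fun i _ => card_support_prod_le _ _
    _ ≤ ∑ _i : Fin k, ∏ _j : Fin m, t :=
        sum_le_sum fun i _ => prod_le_prod (fun j _ => Nat.zero_le _) fun j _ => hg i j
    _ = k * t ^ m := by simp

/-- **Counting floor.** `k t^m < 2^n` ⟹ the expression is not `V_n`. [folklore] -/
theorem sumProd_ne_map_tavenasV_of_lt {k m t n : ℕ} (g : Fin k → Fin m → ℝ[X])
    (hg : ∀ i j, (g i j).support.card ≤ t) (hlt : k * t ^ m < 2 ^ n) :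
    (∑ i, ∏ j, g i j) ≠ (tavenasV n).map (Int.castRingHom ℝ) := by
  intro h
  have h1 := card_support_sumProd_le g hg
  rw [h, card_support_map_tavenasV] at h1
  omega

/-- General budget lemma: any budget `(K, M, T)`, `T(n) ≥ 1`, with `K(n) T(n)^(M(n)) < 2^n` at one `n`
kills the conclusion with that budget. [folklore] -/
theorem conclusion_false_of_budget_lt (K M T : ℕ → ℕ)
    (h : ∃ n, 0 < T n ∧ K n * T n ^ M n < 2 ^ n) :
    ¬ ∀ n : ℕ, ∃ (k m t : ℕ) (g : Fin k → Fin m → Polynomial ℝ),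
        k ≤ K n ∧ m ≤ M n ∧ t ≤ T n ∧ (∀ i j, (g i j).support.card ≤ t) ∧
          (∑ i, ∏ j, g i j) = (tavenasV n).map (Int.castRingHom ℝ) := by
  intro hall
  obtain ⟨n, hT, hn⟩ := h
  obtain ⟨k, m, t, g, hk, hm, ht, hg, hsum⟩ := hall n
  refine sumProd_ne_map_tavenasV_of_lt g hg (lt_of_le_of_lt ?_ hn) hsum
  calc k * t ^ m ≤ K n * T n ^ m := Nat.mul_le_mul hk (Nat.pow_le_pow_left ht m)
    _ ≤ K n * T n ^ M n := Nat.mul_le_mul_left _ (Nat.pow_le_pow_right hT hm)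

/-- The arithmetic of the two refuted strengthenings (`A = C² + C` in `exists_pow_sqrt_lt_two_pow`). [folklore] -/
theorem exists_budget_lt_two_pow (C : ℕ) :
    ∃ n : ℕ, (n + 2) ^ (C * (Nat.sqrt (2 * n + 3) + 1)) *
        ((n + 2) ^ (C * (Nat.sqrt (2 * n + 3) + 1))) ^ C < 2 ^ n ∧
      (n + 2) ^ (C * (Nat.sqrt (2 * n + 3) + 1)) *
        ((n + 2) ^ C) ^ (C * (Nat.sqrt (2 * n + 3) + 1)) < 2 ^ n := by
  obtain ⟨n, hn⟩ := exists_pow_sqrt_lt_two_pow (C * C + C)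
  set s : ℕ := Nat.sqrt (2 * n + 3) with hs
  have hle : (n + 2) ^ ((C * C + C) * (s + 1)) ≤ (n + 2) ^ ((C * C + C) * (s + 4)) :=
    Nat.pow_le_pow_right (by omega) (Nat.mul_le_mul_left _ (by omega))
  refine ⟨n, ?_, ?_⟩
  · calc (n + 2) ^ (C * (s + 1)) * ((n + 2) ^ (C * (s + 1))) ^ C
        = (n + 2) ^ ((C * C + C) * (s + 1)) := by rw [← pow_mul, ← pow_add]; ring_nf
      _ < 2 ^ n := lt_of_le_of_lt hle hn
  · calc (n + 2) ^ (C * (s + 1)) * ((n + 2) ^ C) ^ (C * (s + 1))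
        = (n + 2) ^ ((C * C + C) * (s + 1)) := by rw [← pow_mul, ← pow_add]; ring_nf
      _ < 2 ^ n := lt_of_le_of_lt hle hn

/-- **Where counting stops**: at the crux's own budget, `K T^M ≥ 2^n` at EVERY `n` (`C ≥ 1`), because
`(⌊√(2n+3)⌋+1)² > 2n+3 ≥ n`.  The crux lives just above the counting floor. [folklore] -/
theorem two_pow_le_stated_budget (C n : ℕ) (hC : 1 ≤ C) :
    2 ^ n ≤ (n + 2) ^ (C * (Nat.sqrt (2 * n + 3) + 1)) *
      ((n + 2) ^ (C * (Nat.sqrt (2 * n + 3) + 1))) ^ (C * (Nat.sqrt (2 * n + 3) + 1)) := by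
  set s : ℕ := Nat.sqrt (2 * n + 3) with hs
  have h1 : 2 * n + 3 < (s + 1) * (s + 1) := Nat.lt_succ_sqrt (2 * n + 3)
  have h3 : 1 * (s + 1) * (1 * (s + 1)) ≤ C * (s + 1) * (C * (s + 1)) :=
    Nat.mul_le_mul (Nat.mul_le_mul_right _ hC) (Nat.mul_le_mul_right _ hC)
  have h2 : n ≤ C * (s + 1) * (C * (s + 1)) :=
    le_trans (by omega : n ≤ 2 * n + 3) (le_trans h1.le (by simpa only [one_mul] using h3))
  calc 2 ^ n ≤ (n + 2) ^ n := Nat.pow_le_pow_left (by omega) n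
    _ ≤ (n + 2) ^ (C * (s + 1) * (C * (s + 1))) := Nat.pow_le_pow_right (by omega) h2
    _ = ((n + 2) ^ (C * (s + 1))) ^ (C * (s + 1)) := pow_mul _ _ _
    _ ≤ _ := Nat.le_mul_of_pos_left _ (by positivity)

/-! ### (c) natural strengthenings of the conclusion that are FALSE outright -/

/-- The conclusion with BOUNDED product fan-in `m ≤ C` (else verbatim). -/
def ConclusionBoundedFanin : Prop :=
  ∃ C : ℕ, ∀ n : ℕ, ∃ (k m t : ℕ) (g : Fin k → Fin m → Polynomial ℝ),
    k ≤ (n + 2) ^ (C * (Nat.sqrt (2 * n + 3) + 1)) ∧ m ≤ C ∧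
    t ≤ (n + 2) ^ (C * (Nat.sqrt (2 * n + 3) + 1)) ∧ (∀ i j, (g i j).support.card ≤ t) ∧
      (∑ i, ∏ j, g i j) = (tavenasV n).map (Int.castRingHom ℝ)

/-- **Bounded fan-in is false**: `k t^m ≤ (n+2)^((C²+C)(s+1)) < 2^n` at some `n = 4^j`. [folklore] -/
theorem not_conclusion_bounded_fanin : ¬ ConclusionBoundedFanin := by
  rintro ⟨C, hC⟩
  refine conclusion_false_of_budget_lt
    (fun n => (n + 2) ^ (C * (Nat.sqrt (2 * n + 3) + 1))) (fun _ => C)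
    (fun n => (n + 2) ^ (C * (Nat.sqrt (2 * n + 3) + 1))) ?_ hC
  obtain ⟨n, hn, -⟩ := exists_budget_lt_two_pow C
  exact ⟨n, by positivity, hn⟩

/-- The conclusion with POLYNOMIAL sparsity `t ≤ (n+2)^C` (else verbatim). -/
def ConclusionPolySparsity : Prop :=
  ∃ C : ℕ, ∀ n : ℕ, ∃ (k m t : ℕ) (g : Fin k → Fin m → Polynomial ℝ),
    k ≤ (n + 2) ^ (C * (Nat.sqrt (2 * n + 3) + 1)) ∧ m ≤ C * (Nat.sqrt (2 * n + 3) + 1) ∧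
    t ≤ (n + 2) ^ C ∧ (∀ i j, (g i j).support.card ≤ t) ∧
      (∑ i, ∏ j, g i j) = (tavenasV n).map (Int.castRingHom ℝ)

/-- **Polynomial sparsity is false**: `k t^m ≤ (n+2)^(C(s+1)) (n+2)^(C·C(s+1)) < 2^n`. [folklore] -/
theorem not_conclusion_poly_sparsity : ¬ ConclusionPolySparsity := by
  rintro ⟨C, hC⟩
  refine conclusion_false_of_budget_lt
    (fun n => (n + 2) ^ (C * (Nat.sqrt (2 * n + 3) + 1))) (fun n => C * (Nat.sqrt (2 * n + 3) + 1))
    (fun n => (n + 2) ^ C) ?_ hC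
  obtain ⟨n, -, hn⟩ := exists_budget_lt_two_pow C
  exact ⟨n, by positivity, hn⟩

/-- So the bounded-fan-in TRANSFER is the summit in disguise: it negates its own antecedent. [folklore] -/
theorem transfer_bounded_fanin_iff_valiantsHypothesis :
    (IsPComputable (fun n => perPoly (Fin n) ℂ) → ConclusionBoundedFanin) ↔ ValiantsHypothesis :=
  ⟨fun h => perNotPComputableComplex_iff_holds.mp fun hP => not_conclusion_bounded_fanin (h hP),
    fun hV hP => absurd hP (perNotPComputableComplex_iff_holds.mpr hV)⟩

/-- … and so is the polynomial-sparsity transfer. [folklore] -/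
theorem transfer_poly_sparsity_iff_valiantsHypothesis :
    (IsPComputable (fun n => perPoly (Fin n) ℂ) → ConclusionPolySparsity) ↔ ValiantsHypothesis :=
  ⟨fun h => perNotPComputableComplex_iff_holds.mp fun hP => not_conclusion_poly_sparsity (h hP),
    fun hV hP => absurd hP (perNotPComputableComplex_iff_holds.mpr hV)⟩

/-! ### (d) corners of the stated budget -/

/-- `C = 0` fails at `n = 1` (`m = 0`, `k ≤ 1`: the expression is the constant `k`; `V_1 = 1 + X`). [folklore] -/
theorem conclusion_false_at_C_zero :
    ¬ ∀ n : ℕ, ∃ (k m t : ℕ) (g : Fin k → Fin m → Polynomial ℝ),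
        k ≤ (n + 2) ^ (0 * (Nat.sqrt (2 * n + 3) + 1)) ∧ m ≤ 0 * (Nat.sqrt (2 * n + 3) + 1) ∧
        t ≤ (n + 2) ^ (0 * (Nat.sqrt (2 * n + 3) + 1)) ∧ (∀ i j, (g i j).support.card ≤ t) ∧
          (∑ i, ∏ j, g i j) = (tavenasV n).map (Int.castRingHom ℝ) := by
  intro h
  obtain ⟨k, m, t, g, hk, hm, ht, hg, hsum⟩ := h 1
  simp only [zero_mul, pow_zero, nonpos_iff_eq_zero] at hk hm ht
  subst hm
  exact sumProd_ne_map_tavenasV_of_lt g hg (by rw [pow_zero, mul_one]; omega) hsum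

/-- `n = 0` is satisfiable for every `C` (`V_0 = 1`, `k = 1`, `m = 0`, empty product). [folklore] -/
theorem conclusion_holds_at_zero (C : ℕ) :
    ∃ (k m t : ℕ) (g : Fin k → Fin m → Polynomial ℝ),
        k ≤ (0 + 2) ^ (C * (Nat.sqrt (2 * 0 + 3) + 1)) ∧ m ≤ C * (Nat.sqrt (2 * 0 + 3) + 1) ∧
        t ≤ (0 + 2) ^ (C * (Nat.sqrt (2 * 0 + 3) + 1)) ∧ (∀ i j, (g i j).support.card ≤ t) ∧
          (∑ i, ∏ j, g i j) = (tavenasV 0).map (Int.castRingHom ℝ) := by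
  refine ⟨1, 0, 0, fun _ j => j.elim0, Nat.one_le_pow _ _ (by omega), Nat.zero_le _, Nat.zero_le _,
    fun _ j => j.elim0, ?_⟩
  rw [map_tavenasV]
  simp [vExp]

/-- The SWAPPED conclusion `∀ n ∃ C` is trivial (`V_n` = its `2^n` monomials, `C = n + 1`). [folklore] -/
theorem conclusion_forall_n_exists_C (n : ℕ) :
    ∃ (C k m t : ℕ) (g : Fin k → Fin m → Polynomial ℝ),
        k ≤ (n + 2) ^ (C * (Nat.sqrt (2 * n + 3) + 1)) ∧ m ≤ C * (Nat.sqrt (2 * n + 3) + 1) ∧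
        t ≤ (n + 2) ^ (C * (Nat.sqrt (2 * n + 3) + 1)) ∧ (∀ i j, (g i j).support.card ≤ t) ∧
          (∑ i, ∏ j, g i j) = (tavenasV n).map (Int.castRingHom ℝ) := by
  set s : ℕ := Nat.sqrt (2 * n + 3) with hs
  have hE : 1 ≤ (n + 1) * (s + 1) := Nat.one_le_iff_ne_zero.mpr (by positivity)
  have hpow : 1 ≤ (n + 2) ^ ((n + 1) * (s + 1)) := Nat.one_le_pow _ _ (by omega)
  refine ⟨n + 1, 2 ^ n, 1, 1, fun i _ => C ((2 : ℝ) ^ vExp n i) * X ^ (i : ℕ), ?_, hE, hpow, ?_, ?_⟩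
  · calc 2 ^ n ≤ (n + 2) ^ n := Nat.pow_le_pow_left (by omega) n
      _ ≤ (n + 2) ^ ((n + 1) * (s + 1)) := Nat.pow_le_pow_right (by omega) (by nlinarith)
  · intro i j
    exact card_support_C_mul_X_pow_le_one
  · rw [map_tavenasV]
    simp only [Finset.prod_const, Finset.card_univ, Fintype.card_fin, pow_one]
    exact Fin.sum_univ_eq_sum_range (fun i => C ((2 : ℝ) ^ vExp n i) * X ^ i) (2 ^ n)

end Summit.ValiantsHypothesis.ValiantsHypothesis.Cruxes.RealVnTransfer.Disproof
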